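import Literature.NumberTheory.Transcendental.L2HodgeTheory
import Literature.Geometry.Kaehler.RiemannianHodgeAdjointProofs
import HarnessLib

/-!
# Harmonic forms are `L²`-orthogonal to exact forms (Warner, Thm. 6.8) — proofs

Topic: the real `L²` Hodge theory of `Literature/NumberTheory/Transcendental/L2HodgeTheory.lean`
(`Literature.Geometry.Kaehler.MForm.l2Inner o α β = ∫_M ⟪α, β⟫ vol_o`,
`Literature.NumberTheory.Transcendental.IsL2Orthogonal`, and the named fact
`Literature.NumberTheory.Transcendental.isL2Orthogonal_harmonicForms_exactSmoothForms`), in the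
line of the sibling proof files `L2HodgeTheoryProofs.lean` (`⟪α, β⟫ = ∫_M α ∧ ⋆β`) and
`L2HodgeTheoryExactCoexactProofs.lean` (`d(E^{k}) ⟂ δ(E^{k+2})`). Source: F. W. Warner,
*Foundations of Differentiable Manifolds and Lie Groups*, GTM 94 (1983), Ch. 6 — standing
hypothesis (p. 220): "`M` will be a compact oriented Riemannian manifold of dimension `n`"
(manifolds are Hausdorff, second countable and without boundary, Def. 1.3; metrics are `C^∞`,
4.10); `⟨α, β⟩ = ∫_M α ∧ *β` (6.1 (5), p. 220); Prop. 6.2 (p. 220: `⟨dα, β⟩ = ⟨α, δβ⟩`),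
Prop. 6.3 (p. 221: `Δα = 0 ↔ dα = 0 ∧ δα = 0`), Def. 6.7 (p. 222: `H^p = {ω ∈ E^p(M) : Δω = 0}`)
and the Hodge decomposition Thm. 6.8 (pp. 222–223), `E^p(M) = d(E^{p-1}) ⊕ δ(E^{p+1}) ⊕ H^p`
orthogonally, whose orthogonality assertions "follow from 6.1 (3), 6.2, and 6.3" (proof, p. 223).

## Main statements (all proved)

* `Literature.NumberTheory.Transcendental.l2Inner_mextDeriv_right_eq_zero_of_mcoderiv_eq_zero`:
  a smooth co-closed form is `L²`-orthogonal to every exact smooth form,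
  `δα = 0 → ⟪α, dγ⟫ = ⟪γ, δα⟫ = 0` (Prop. 6.2).
* `Literature.NumberTheory.Transcendental.harmonicForms_isL2Orthogonal_exactSmoothForms` —
  **Thm. 6.8, the orthogonality `H^k ⟂ d(E^{k-1})`**: on a compact oriented Riemannian manifold
  without boundary (Hausdorff, `C^∞` manifold, `C^∞` metric, `vol_o` smooth), the harmonic
  `k`-forms `harmonicForms o h` are `L²`-orthogonal to the exact smooth `k`-forms
  `exactSmoothForms I M ℝ k`.
* `Literature.NumberTheory.Transcendental.isL2Orthogonal_harmonicForms_exactSmoothForms_of_compactSpace`: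
  in the presence of those instances the named fact
  `isL2Orthogonal_harmonicForms_exactSmoothForms o` of `L2HodgeTheory.lean` holds as declared.

## Why `isL2Orthogonal_harmonicForms_exactSmoothForms` is not discharged outright (provefact pass, 2026-08-15)

That `def … : Prop` of `L2HodgeTheory.lean` was written inside
`section Closed; variable [CompactSpace M] [I.Boundaryless] [IsContinuousRiemannianBundle E _]
[IsContMDiffRiemannianBundle I ∞ E _]`, but a `def` does not abstract section instances its body
does not use: `#check @isL2Orthogonal_harmonicForms_exactSmoothForms` binds only
`[T2Space M] [SigmaCompactSpace M] [IsManifold I ∞ M] [RiemannianBundle _] (o) {k m}`. As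
declared it therefore asserts `H^k ⟂ B^k` on *every* σ-compact Hausdorff `C^∞` manifold —
compact or not, with or without boundary — for fibre metrics of no regularity. That is not
Warner's theorem and it is not provable: on `M = [0, 1]` (model with boundary `𝓡∂ 1`,
Euclidean metric, standard orientation) the `1`-form `dx` is harmonic (`⋆dx = 1`, so
`δ dx = ±⋆d⋆dx = 0` and `Δ dx = dδ dx = 0`) and exact (`dx = d(x)`), yet
`⟪dx, dx⟫ = ∫₀¹ dx = 1 ≠ 0` — the boundary term `∫_{∂M} γ ∧ *α` that Warner's identity
`⟨dγ, α⟩ - ⟨γ, δα⟩ = ∫_M d(γ ∧ *α)` acquires when `∂M ≠ ∅`; on a non-compact `M` the value of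
`MForm.integral` (a `finsum` of chart integrals against a partition of unity chosen by
`Classical.choose`) carries no information; and for a discontinuous fibre metric the chart-wise
(`fderivWithin`-based) `d` returns junk values, so that forms with `δα ≠ 0` become "harmonic"
(the mechanism recorded in the module docstrings of
`Literature/Geometry/Kaehler/RiemannianHodgeAdjointProofs.lean` and
`Literature/Geometry/Kaehler/RiemannianHodgeRoughMetric.lean`). Warner's hypotheses — compact, no
boundary, smooth metric (p. 220) — are exactly the dropped instances. Following the provefact
protocol (a mis-stated named fact is corrected under a new name, never edited in place) the
result is proved here under the intended instances (`harmonicForms_isL2Orthogonal_exactSmoothForms`)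
together with the bridge `isL2Orthogonal_harmonicForms_exactSmoothForms_of_compactSpace`. The same
dropped-instance defect affects every `def` of `section Closed` of `L2HodgeTheory.lean` (listed in
`L2HodgeTheoryExactCoexactProofs.lean`).

## Proof (as printed, Warner p. 223 with 6.2, 6.3, 6.7)

In degree `0` there are no exact forms (`exactSmoothForms … 0 = ⊥`, and `⟪α, 0⟫ = 0`). In degree
`k + 1`: an element of `harmonicForms o h = span {α smooth | Δα = 0}` is itself smooth with
`Δα = 0`, the harmonic forms being a subspace for a smooth metric (Def. 6.7 / 6.1,
`mem_harmonicForms_iff_of_facts` fed `inChart_mextDeriv_holds` and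
`isSmoothForm_hodgeStar_of_contMDiffMetric`); hence `δα = 0` (Prop. 6.3,
`isHarmonicForm_iff_closed_and_coclosed`). An exact smooth `(k+1)`-form is `dγ` with `γ` smooth
(`exists_eq_mextDeriv_of_mem_exactSmoothForms`). Then
`⟪α, dγ⟫ = ⟪dγ, α⟫ = ⟪γ, δα⟫ = ⟪γ, 0⟫ = 0` by symmetry (`MForm.l2Inner_symm`), Prop. 6.2 in `L²`
form (the wedge identity `∫_M dγ ∧ ⋆α = ∫_M γ ∧ ⋆δα`, `integral_mextDeriv_wedge_hodgeStar`, i.e.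
Stokes, read through `α ∧ ⋆β = ⟪α, β⟫ vol`, `MForm.wedge_hodgeStar`; equivalently
`MForm.l2Inner_mextDeriv_left_of_isSmoothForm` of `L2HodgeTheoryExactCoexactProofs.lean`) and
`MForm.l2Inner_smul_left`. All ingredients are discharged theorems of the tree; no named fact is
assumed.

## References

* F. W. Warner, *Foundations of Differentiable Manifolds and Lie Groups*, GTM 94, Springer
  (1983): 6.1 (p. 220), Prop. 6.2 (p. 220), Prop. 6.3 (p. 221), Def. 6.7 (p. 222), Thm. 6.8 and
  its proof (pp. 222–223).
* J. Jost, *Riemannian Geometry and Geometric Analysis*, §3.4.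

## Verdict clean-up note (2026-08-15)

The named fact `isL2Orthogonal_harmonicForms_exactSmoothForms` is now an `@[deprecated]` record of
`L2HodgeTheory.lean` (mis-stated, resp. refuted as stated: a `def` does not abstract the unused
section instances it was written under; the corrected statements are the ones proved or named in
this file and in the records' docstrings). The declaration
`isL2Orthogonal_harmonicForms_exactSmoothForms_of_compactSpace` names the record on purpose, so
`linter.deprecated` is silenced on exactly that declaration (REMOVE-WHEN the records are deleted
from `L2HodgeTheory.lean`).
-/

noncomputable section

open scoped Manifold ContDiff Topology
open Bundle Module Set
open Literature.Geometry.Kaehler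

namespace Literature.NumberTheory.Transcendental

variable {E : Type*} [NormedAddCommGroup E] [NormedSpace ℝ E] [FiniteDimensional ℝ E]
  {n : ℕ} [Fact (finrank ℝ E = n)] [MeasurableSpace E] [BorelSpace E]
  {H : Type*} [TopologicalSpace H] {I : ModelWithCorners ℝ E H}
  {M : Type*} [TopologicalSpace M] [ChartedSpace H M] [T2Space M] [CompactSpace M]
  [I.Boundaryless] [IsManifold I ∞ M] [RiemannianBundle (fun x : M ↦ TangentSpace I x)]
  [IsContinuousRiemannianBundle E (fun x : M ↦ TangentSpace I x)]
  [IsContMDiffRiemannianBundle I ∞ E (fun x : M ↦ TangentSpace I x)]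
  (o : (x : M) → Orientation ℝ (TangentSpace I x) (Fin n)) {k m : ℕ}

/-- A smooth **co-closed** form is `L²`-orthogonal to every exact smooth form: if `δα = 0` for a
smooth `(k+1)`-form `α`, then `⟪α, dγ⟫ = ⟪dγ, α⟫ = ⟪γ, δα⟫ = ⟪γ, 0⟫ = 0` for every smooth `k`-form
`γ` (Warner (1983), proof of Thm. 6.8, p. 223, via Prop. 6.2, p. 220). Compact oriented Riemannian
manifold without boundary, `C^∞` metric, `vol_o` smooth; degrees via `h : (k + 1) + m = n`.
[cite: WarnerGTM94, Thm. 6.8, p. 223] -/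
theorem l2Inner_mextDeriv_right_eq_zero_of_mcoderiv_eq_zero
    (ho : IsSmoothForm (riemannianVolumeForm o)) (h : (k + 1) + m = n) {α : MForm I M ℝ (k + 1)}
    (hα : IsSmoothForm α) (hδ : mcoderiv o h α = 0) {γ : MForm I M ℝ k} (hγ : IsSmoothForm γ) :
    MForm.l2Inner o α (mextDeriv γ) = 0 := by
  -- Prop. 6.2 in the wedge form `∫ dγ ∧ ⋆α = ∫ γ ∧ ⋆δα`, integrands `⟪dγ, α⟫ vol`, `⟪γ, δα⟫ vol`
  have hadj := integral_mextDeriv_wedge_hodgeStar o ho h hγ hα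
  rw [MForm.wedge_hodgeStar, MForm.wedge_hodgeStar, hδ] at hadj
  -- `⟪α, dγ⟫ = ⟪dγ, α⟫ = ⟪γ, 0⟫ = ⟪0, γ⟫ = 0`
  rw [MForm.l2Inner_symm, MForm.l2Inner, hadj, ← MForm.l2Inner, MForm.l2Inner_symm]
  simpa using MForm.l2Inner_smul_left o (0 : ℝ) (0 : MForm I M ℝ k) γ

/-- **Harmonic forms are `L²`-orthogonal to exact forms** — the orthogonality `H^k ⟂ d(E^{k-1})`
in Warner's Hodge decomposition (1983), Thm. 6.8, pp. 222–223 (proof, p. 223: the orthogonality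
"follow[s] from 6.1 (3), 6.2, and 6.3"). On a compact oriented Riemannian manifold without
boundary — Hausdorff, `C^∞` manifold, `C^∞` metric, `vol_o` smooth (`o` locally constant) — and
for degrees `h : k + m = n`, the space `harmonicForms o h` (the span of the smooth `k`-forms with
`Δα = 0`, Def. 6.7) is `L²`-orthogonal to `exactSmoothForms I M ℝ k` (`⊥` in degree `0`, the span
of `d (E^{k-1}(M))` in positive degree). Proof as printed: a member of `harmonicForms` is harmonic
(`mem_harmonicForms_iff_of_facts`, the harmonic forms being a subspace for a smooth metric), hence
co-closed (Prop. 6.3, `isHarmonicForm_iff_closed_and_coclosed`); an exact smooth form is `dγ`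
with `γ` smooth (`exists_eq_mextDeriv_of_mem_exactSmoothForms`); and `⟪α, dγ⟫ = ⟪γ, δα⟫ = 0`
(Prop. 6.2, `l2Inner_mextDeriv_right_eq_zero_of_mcoderiv_eq_zero`). This is the
correctly-hypothesised form of the named fact `isL2Orthogonal_harmonicForms_exactSmoothForms`
(see the module docstring). [cite: WarnerGTM94, Thm. 6.8, pp. 222–223] -/
theorem harmonicForms_isL2Orthogonal_exactSmoothForms (ho : IsSmoothForm (riemannianVolumeForm o))
    (h : k + m = n) :
    IsL2Orthogonal o (harmonicForms o h : Set (MForm I M ℝ k)) (exactSmoothForms I M ℝ k) := by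
  intro α hα β hβ
  cases k with
  | zero =>
    -- there are no exact `0`-forms
    have hβ0 : β = 0 := by simpa [exactSmoothForms] using hβ
    rw [hβ0, MForm.l2Inner_symm]
    simpa using MForm.l2Inner_smul_left o (0 : ℝ) (0 : MForm I M ℝ 0) α
  | succ k =>
    -- a member of the span of the harmonic forms is harmonic (smooth metric), hence co-closed
    have hαH : IsHarmonicForm o h α :=
      (mem_harmonicForms_iff_of_facts o (inChart_mextDeriv_holds I M ℝ)
        (fun {k m} ↦ isSmoothForm_hodgeStar_of_contMDiffMetric (k := k) (m := m) o) ho h α).1 hα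
    have hδ : mcoderiv o h α = 0 := ((isHarmonicForm_iff_closed_and_coclosed o ho h hαH.1).1 hαH).2
    -- an exact smooth form is `dγ`, `γ` smooth
    obtain ⟨γ, hγ, rfl⟩ := exists_eq_mextDeriv_of_mem_exactSmoothForms hβ
    exact l2Inner_mextDeriv_right_eq_zero_of_mcoderiv_eq_zero o ho h hαH.1 hδ hγ

-- names the `@[deprecated]` record `isL2Orthogonal_harmonicForms_exactSmoothForms` on purpose (verdict clean-up 2026-08-15); REMOVE-WHEN the
-- record is deleted from `L2HodgeTheory.lean`
set_option linter.deprecated false in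
/-- **Bridge to the named fact as declared.** In the presence of the intended instances
(`CompactSpace M`, `I.Boundaryless`, continuous and `C^∞` Riemannian metric) the named fact
`isL2Orthogonal_harmonicForms_exactSmoothForms o` of `L2HodgeTheory.lean` — whose `def` dropped
exactly these instances, see the module docstring — holds: its body quantifies `ho` and `h`
itself and is then `harmonicForms_isL2Orthogonal_exactSmoothForms`. Warner (1983), Thm. 6.8,
pp. 222–223. [cite: WarnerGTM94, Thm. 6.8, pp. 222–223] -/
theorem isL2Orthogonal_harmonicForms_exactSmoothForms_of_compactSpace :
    isL2Orthogonal_harmonicForms_exactSmoothForms (k := k) (m := m) o :=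
  fun ho h ↦ harmonicForms_isL2Orthogonal_exactSmoothForms o ho h

end Literature.NumberTheory.Transcendental
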